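import Summits.CriticalPhenomena.PercolationContinuityZ3.Cruxes.GoodBoxesLikelyWhenPercolating.StrategyCensus3826
import Literature.Probability.Percolation.UniformPercolation
import Literature.Probability.Percolation.LocalLimitConnections
import Literature.Probability.Percolation.HalfSpaceBGN
import Literature.Probability.Percolation.ContinuityCriterion
import Literature.Probability.Percolation.ConnectivityContinuityProofs
import Literature.Probability.Percolation.CriticalContinuityProofs

/-!
# Strategy census r1 (second opinion) — crux `GoodBoxesLikelyWhenPercolating` (stmt-CriticalPhenomena-3826)

Kernel-checked backbone of the r1 `STRATEGY-CENSUS.md` (redirect strategist, second opinion with a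
different technique inventory) for the remaining crux r2 of `route-CriticalPhenomena-PercOpenSupercrit`.

§0 re-verifies the collapse recorded by the first census (`StrategyCensus3826.lean`, imported):
   `r2 → θ(p_c)=0` is ONE application of the certified `closes` to the landed r3
   (`goodBoxCriterionSameP_proof`, p151477), and `r2 ↔ S ∧ SupercritGoodBoxes`.
§1 isolates the MECHANISM of the collapse as a two-line lemma (`summit_of_noGo_at_pc`,
   `jumpShape_iff`): every statement of the shape "`θ(p) > 0 ⇒ E(p)`" whose conclusion `E` is
   refuted AT `p = p_c` by a tree theorem is summit-strength, and is equivalent to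
   `S ∧ (E on p > p_c)`. r2 is the instance `E = (∀ δ ∃ n, P_p(G_n) > 1-δ)` with the no-go
   `real_goodBox_criticalProbI_le` (NoGoodBoxAtPc). This is the test applied in the census to every
   candidate re-typing of r2 ("does the finite-size signature survive at `p_c` under the jump?").
§2 the two REGIME FACES of `S` — approach from above (`SupercritFace`: `inf_{p>p_c} θ(p) = 0`) and
   approach from below (`SubcritFace`: connectivities decay uniformly over the whole subcritical
   phase) — are each proved EQUIVALENT to `S` (upper semicontinuity of `θ` from finite-volume
   approximation + continuity of local events; lower semicontinuity of `τ_p(0,x)` in `p`). Hence the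
   natural decomposition "Face⁺ ∧ Face⁻" has BOTH pieces `↔ S` (clause (c) of the redirect test fails).
§3 the remaining candidate splits of r2 itself: by parameter (`p > p_c` / `p = p_c`: the critical
   piece is `↔ S`, `critGoodBoxes_iff`), and by event (`CROSS`/`UNIQ`: assembly proved here, and the
   `UNIQ` piece gives `S` outright once the closable `CROSS` piece holds at `p_c` —
   `summit_of_uniqFrequently`), so in each split one piece is the summit.

§4 refutes the one strengthening that would make r2 inductable in `p` (a scale uniform over `p > p_c`):
   false by NoGoodBoxAtPc + continuity of the box polynomial (`uniformSupercritGoodBoxes_false`).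

No `sorry`; axioms standard. Nothing here is a Theorems/ landing: it is strategist evidence.
-/

noncomputable section

namespace Summit.CriticalPhenomena.PercolationContinuityZ3.Cruxes.GoodBoxesLikelyWhenPercolating.StrategyCensusR1

open MeasureTheory Filter Topology
open Literature.Probability.Percolation Literature.Probability.LatticeModels
open Summit.CriticalPhenomena.PercolationContinuityZ3.Theses.PercOpenSupercrit
open Summit.CriticalPhenomena.PercolationContinuityZ3.Theorems.RenormaliseFromLinearLRO
  (goodBox goodBoxCriterionSameP_proof real_goodBox_criticalProbI_le continuous_real_goodBox)
open Summit.CriticalPhenomena.PercolationContinuityZ3.Cruxes.GoodBoxesLikelyWhenPercolating.StrategyCensus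

/-! ## §0 Re-verification of the collapse -/

/-- `r2 → θ(p_c) = 0`: the route's certified deciding theorem `closes`, second hypothesis (r3)
discharged by the landed `goodBoxCriterionSameP_proof` (p151477). -/
theorem summit_of_crux (h : GoodBoxesLikelyWhenPercolating) : _root_.PercolationContinuityZ3 :=
  closes h goodBoxCriterionSameP_proof

/-- The first census' collapse theorem, re-checked by import. -/
example : GoodBoxesLikelyWhenPercolating ↔ (_root_.PercolationContinuityZ3 ∧ SupercritGoodBoxes) :=
  crux_iff

/-! ## §1 The mechanism: a no-go at `p_c` turns any `θ > 0 ⇒ E` statement into the summit -/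

/-- **Jump elimination.** If `E(p)` follows from `θ(p) > 0` for every `p`, and `E(p_c)` is false,
then `θ(p_c) = 0`. (Two lines; this is all the deciding theorem of the route does once r3 is a
theorem.) -/
theorem summit_of_noGo_at_pc {E : unitInterval → Prop}
    (h : ∀ p : unitInterval, 0 < theta (zdGraph 3) (0 : Site 3) p → E p)
    (hno : ¬ E (criticalProbI 3)) : _root_.PercolationContinuityZ3 := by
  show theta (zdGraph 3) (0 : Site 3) (criticalProbI 3) = 0
  by_contra hne
  exact hno (h _ (lt_of_le_of_ne measureReal_nonneg (Ne.symm hne)))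

/-- **The collapse shape.** With a no-go at `p_c`, "`θ(p) > 0 ⇒ E(p)` for all `p`" is
`S ∧ (E on the open supercritical ray)`: the only `p` at which the statement can say anything
not already supercritical is `p = p_c`, and there it says `¬ (θ(p_c) > 0)`. -/
theorem jumpShape_iff {E : unitInterval → Prop} (hno : ¬ E (criticalProbI 3)) :
    (∀ p : unitInterval, 0 < theta (zdGraph 3) (0 : Site 3) p → E p) ↔
      (_root_.PercolationContinuityZ3 ∧
        ∀ p : unitInterval, criticalProb (zdGraph 3) (0 : Site 3) < (p : ℝ) → E p) := by
  constructor
  · intro h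
    exact ⟨summit_of_noGo_at_pc h hno,
      fun p hp => h p (theta_pos_of_criticalProb_lt_holds (zdGraph 3) (0 : Site 3) p hp)⟩
  · rintro ⟨hS, hE⟩ p hp
    refine hE p ?_
    by_contra hle
    push Not at hle
    rcases hle.lt_or_eq with hlt | heq
    · exact absurd (theta_eq_zero_of_lt_criticalProb_holds (zdGraph 3) (0 : Site 3) p hlt) (ne_of_gt hp)
    · have hpc : p = criticalProbI 3 := Subtype.ext heq
      rw [hpc] at hp
      exact absurd hS (ne_of_gt hp)

/-- The no-go at `p_c` for the typed good-box signature (NoGoodBoxAtPc, landed, unconditional). -/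
theorem noGoodBox_at_pc :
    ¬ (∀ δ : ℝ, 0 < δ → ∃ n : ℕ, 1 ≤ n ∧
        1 - δ < (bondPercolation (zdGraph 3) (criticalProbI 3)).real (goodBox n)) := by
  intro h
  obtain ⟨δ, hδ, hle⟩ := real_goodBox_criticalProbI_le
  obtain ⟨n, hn, hgt⟩ := h δ hδ
  exact absurd (hle n hn) (not_le.2 hgt)

/-- r2 is literally the jump shape with `E p = (∀ δ > 0, ∃ n ≥ 1, P_p(G_n) > 1 - δ)`; so §1 applies
verbatim (a second, `closes`-free derivation of `r2 → S`). -/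
theorem summit_of_crux' (h : GoodBoxesLikelyWhenPercolating) : _root_.PercolationContinuityZ3 :=
  summit_of_noGo_at_pc
    (E := fun q => ∀ δ : ℝ, 0 < δ → ∃ n : ℕ, 1 ≤ n ∧ 1 - δ < (bondPercolation (zdGraph 3) q).real (goodBox n))
    h noGoodBox_at_pc

/-! ## §2 The two regime faces of `S`, each equivalent to `S` -/

/-- Room on the right of `p_c` in `[0,1]`: every ball around `p_c` contains a point `> p_c`
(because `p_c(ℤ³) < 1`, `criticalProb_zd_lt_one`). -/
theorem exists_gt_pc_mem_ball {r : ℝ} (hr : 0 < r) :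
    ∃ q : unitInterval, criticalProb (zdGraph 3) (0 : Site 3) < (q : ℝ) ∧ q ∈ Metric.ball (criticalProbI 3) r := by
  have hpc1 : criticalProb (zdGraph 3) (0 : Site 3) < 1 := criticalProb_zd_lt_one (by norm_num)
  have hpc0 : 0 ≤ criticalProb (zdGraph 3) (0 : Site 3) := (criticalProb_mem_Icc _ _).1
  set t : ℝ := min (criticalProb (zdGraph 3) (0 : Site 3) + r / 2)
    ((criticalProb (zdGraph 3) (0 : Site 3) + 1) / 2) with ht
  have ht_gt : criticalProb (zdGraph 3) (0 : Site 3) < t := by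
    rw [ht]; exact lt_min (by linarith) (by linarith)
  have ht_le1 : t ≤ 1 := (min_le_right _ _).trans (by linarith)
  have ht0 : 0 ≤ t := hpc0.trans ht_gt.le
  refine ⟨⟨t, ht0, ht_le1⟩, ht_gt, ?_⟩
  rw [Metric.mem_ball, Subtype.dist_eq, Real.dist_eq, coe_criticalProbI]
  show |t - criticalProb (zdGraph 3) 0| < r
  rw [abs_of_pos (sub_pos.2 ht_gt)]
  have : t ≤ criticalProb (zdGraph 3) (0 : Site 3) + r / 2 := min_le_left _ _
  linarith

/-- Room on the left of `p_c` in `[0,1]`: every ball around `p_c` contains a point `< p_c`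
(because `p_c(ℤ³) > 0`, `criticalProb_zd_pos`). -/
theorem exists_lt_pc_mem_ball {r : ℝ} (hr : 0 < r) :
    ∃ q : unitInterval, (q : ℝ) < criticalProb (zdGraph 3) (0 : Site 3) ∧ q ∈ Metric.ball (criticalProbI 3) r := by
  have hpc0 : 0 < criticalProb (zdGraph 3) (0 : Site 3) := criticalProb_zd_pos 3 (by norm_num)
  have hpc1 : criticalProb (zdGraph 3) (0 : Site 3) ≤ 1 := (criticalProb_mem_Icc _ _).2
  set t : ℝ := max (criticalProb (zdGraph 3) (0 : Site 3) - r / 2)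
    (criticalProb (zdGraph 3) (0 : Site 3) / 2) with ht
  have ht_lt : t < criticalProb (zdGraph 3) (0 : Site 3) := by
    rw [ht]; exact max_lt (by linarith) (by linarith)
  have ht0 : 0 ≤ t := le_trans (by linarith) (le_max_right _ _)
  have ht1 : t ≤ 1 := ht_lt.le.trans hpc1
  refine ⟨⟨t, ht0, ht1⟩, ht_lt, ?_⟩
  rw [Metric.mem_ball, Subtype.dist_eq, Real.dist_eq, coe_criticalProbI]
  show |t - criticalProb (zdGraph 3) 0| < r
  rw [abs_of_neg (sub_neg.2 ht_lt)]
  have : criticalProb (zdGraph 3) (0 : Site 3) - r / 2 ≤ t := le_max_left _ _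
  linarith

/-- **Face⁺ (approach from above):** `θ` takes arbitrarily small values on the open supercritical
ray, i.e. `inf_{p > p_c} θ(p) = 0` — "no jump seen from the percolating side". -/
def SupercritFace : Prop :=
  ∀ ε : ℝ, 0 < ε → ∃ p : unitInterval,
    criticalProb (zdGraph 3) (0 : Site 3) < (p : ℝ) ∧ theta (zdGraph 3) (0 : Site 3) p < ε

/-- **Face⁻ (approach from below):** connectivities decay uniformly over the whole subcritical
phase: `sup_{p < p_c} τ_p(0,x) → 0` as `x → ∞` — "no long-range order builds up as `p ↑ p_c`". -/
def SubcritFace : Prop :=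
  ∀ ε : ℝ, 0 < ε → ∃ R : ℕ, ∀ p : unitInterval, (p : ℝ) < criticalProb (zdGraph 3) (0 : Site 3) →
    ∀ x : Site 3, x ∉ box 3 R → tau 3 p 0 x < ε

/-- Face⁺ ⇒ S: monotonicity of `θ` in `p`. -/
theorem summit_of_supercritFace (h : SupercritFace) : _root_.PercolationContinuityZ3 := by
  show theta (zdGraph 3) (0 : Site 3) (criticalProbI 3) = 0
  by_contra hne
  have hpos : 0 < theta (zdGraph 3) (0 : Site 3) (criticalProbI 3) :=
    lt_of_le_of_ne measureReal_nonneg (Ne.symm hne)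
  obtain ⟨p, hp, hlt⟩ := h _ hpos
  have hle : criticalProbI 3 ≤ p := Subtype.coe_le_coe.mp (by rw [coe_criticalProbI]; exact hp.le)
  have hmono : theta (zdGraph 3) (0 : Site 3) (criticalProbI 3) ≤ theta (zdGraph 3) (0 : Site 3) p :=
    theta_mono_holds (zdGraph 3) (0 : Site 3) hle
  exact absurd (hmono.trans_lt hlt) (lt_irrefl _)

/-- S ⇒ Face⁺: `θ = inf_n P_p(0 ↔ ∂Λ_n)` is an infimum of functions continuous in `p` (local
events), hence upper semicontinuous; at `p_c` this gives `limsup_{p ↓ p_c} θ(p) ≤ θ(p_c) = 0`.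
Uses `p_c(ℤ³) < 1` to find room on the right. -/
theorem supercritFace_of_summit (hS : _root_.PercolationContinuityZ3) : SupercritFace := by
  intro ε hε
  have hS' : theta (zdGraph 3) (0 : Site 3) (criticalProbI 3) = 0 := hS
  have hlim := tendsto_real_siteToBoundary (d := 3) (criticalProbI 3)
  rw [hS'] at hlim
  have hev : ∀ᶠ n : ℕ in atTop,
      (bondPercolation (zdGraph 3) (criticalProbI 3)).real (siteToBoundary 3 n) ∈ Set.Iio ε :=
    hlim.eventually_mem (Iio_mem_nhds hε)
  obtain ⟨n, hn⟩ := hev.exists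
  have hcont : Continuous fun p : unitInterval => (bondPercolation (zdGraph 3) p).real (siteToBoundary 3 n) :=
    continuous_bondPercolation_real_of_isLocalEvent (zdGraph 3) (isLocalEvent_siteToBoundary 3 n)
  have hopen : IsOpen ((fun p : unitInterval => (bondPercolation (zdGraph 3) p).real (siteToBoundary 3 n)) ⁻¹' Set.Iio ε) :=
    hcont.isOpen_preimage _ isOpen_Iio
  obtain ⟨r, hr, hball⟩ := Metric.isOpen_iff.1 hopen (criticalProbI 3) hn
  obtain ⟨q, hq, hqball⟩ := exists_gt_pc_mem_ball hr
  have hq' : (bondPercolation (zdGraph 3) q).real (siteToBoundary 3 n) < ε := hball hqball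
  exact ⟨q, hq, (DCT16.theta_le_real_siteToBoundary _ n).trans_lt hq'⟩

/-- **Face⁺ ↔ S.** -/
theorem summit_iff_supercritFace : _root_.PercolationContinuityZ3 ↔ SupercritFace :=
  ⟨supercritFace_of_summit, summit_of_supercritFace⟩

/-- Every finite set of sites lies in a box (folklore; copied to avoid a heavy import). -/
theorem exists_subset_box (t : Finset (Site 3)) : ∃ R : ℕ, ∀ z ∈ t, z ∈ box 3 R := by
  refine ⟨t.sup fun z => Finset.univ.sup fun i => (z i).natAbs, fun z hz => mem_box.2 fun i => ?_⟩
  have h1 : (z i).natAbs ≤ Finset.univ.sup fun i => (z i).natAbs :=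
    Finset.le_sup (f := fun i => (z i).natAbs) (Finset.mem_univ i)
  have h2 : (Finset.univ.sup fun i => (z i).natAbs) ≤ t.sup fun z => Finset.univ.sup fun i => (z i).natAbs :=
    Finset.le_sup (f := fun z : Site 3 => Finset.univ.sup fun i => (z i).natAbs) hz
  have h3 : ((z i).natAbs : ℤ) ≤ ((t.sup fun z => Finset.univ.sup fun i => (z i).natAbs : ℕ) : ℤ) := by
    exact_mod_cast h1.trans h2
  have habs : |z i| ≤ ((t.sup fun z => Finset.univ.sup fun i => (z i).natAbs : ℕ) : ℤ) := by
    rw [← Int.natCast_natAbs]; exact h3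
  exact abs_le.1 habs

/-- S ⇒ Face⁻: `τ_{p_c}(0,·) → 0` (`theta_eq_zero_iff_tendsto_tau_cofinite`) and `τ_p ≤ τ_{p_c}`
for `p ≤ p_c` (monotone coupling). -/
theorem subcritFace_of_summit (hS : _root_.PercolationContinuityZ3) : SubcritFace := by
  intro ε hε
  have hS' : theta (zdGraph 3) (0 : Site 3) (criticalProbI 3) = 0 := hS
  have htend : Tendsto (tau 3 (criticalProbI 3) 0) cofinite (𝓝 0) :=
    (theta_eq_zero_iff_tendsto_tau_cofinite (criticalProbI 3)).1 hS'
  have hev : ∀ᶠ x in cofinite, tau 3 (criticalProbI 3) 0 x ∈ Set.Iio ε :=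
    htend.eventually_mem (Iio_mem_nhds hε)
  rw [Filter.eventually_cofinite] at hev
  obtain ⟨R, hR⟩ := exists_subset_box hev.toFinset
  refine ⟨R, fun p hp x hx => ?_⟩
  have hxε : tau 3 (criticalProbI 3) 0 x < ε := by
    by_contra hnot
    exact hx (hR x (hev.mem_toFinset.2 hnot))
  have hle : p ≤ criticalProbI 3 := Subtype.coe_le_coe.mp (by rw [coe_criticalProbI]; exact hp.le)
  have hmono : tau 3 p 0 x ≤ tau 3 (criticalProbI 3) 0 x :=
    DCT16.real_mono_of_isUpperSet (zdGraph 3) (isUpperSet_openConn 0 x)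
      (measurableSet_openConn_holds 0 x) hle
  exact hmono.trans_lt hxε

/-- Face⁻ ⇒ S: `p ↦ τ_p(0,x)` is lower semicontinuous (Grimmett §8.3), so a bound `< ε` holding for
all `p < p_c` passes to `p_c` as `≤ ε` (room on the left: `p_c(ℤ³) > 0`); then `τ_{p_c}(0,·) → 0`
and the continuity criterion gives `θ(p_c) = 0`. -/
theorem summit_of_subcritFace (h : SubcritFace) : _root_.PercolationContinuityZ3 := by
  show theta (zdGraph 3) (0 : Site 3) (criticalProbI 3) = 0
  have key : ∀ ε : ℝ, 0 < ε → ∃ R : ℕ, ∀ x : Site 3, x ∉ box 3 R → tau 3 (criticalProbI 3) 0 x ≤ ε := by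
    intro ε hε
    obtain ⟨R, hR⟩ := h ε hε
    refine ⟨R, fun x hx => ?_⟩
    by_contra hlt
    push Not at hlt
    rw [tau_def] at hlt
    have hlsc := lowerSemicontinuous_real_openConn (zdGraph 3) (0 : Site 3) x (criticalProbI 3) ε hlt
    obtain ⟨r, hr, hball⟩ := Metric.eventually_nhds_iff.1 hlsc
    obtain ⟨q, hq, hqball⟩ := exists_lt_pc_mem_ball hr
    have hbig : ε < (bondPercolation (zdGraph 3) q).real (openConn 0 x) := hball (Metric.mem_ball.1 hqball)
    have hsmall : tau 3 q 0 x < ε := hR q hq x hx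
    rw [tau_def] at hsmall
    linarith
  rw [theta_eq_zero_iff_tendsto_tau_cofinite, Metric.tendsto_nhds]
  intro ε hε
  obtain ⟨R, hR⟩ := key (ε / 2) (half_pos hε)
  refine Filter.eventually_cofinite.2 ((box 3 R).finite_toSet.subset fun x hx => ?_)
  by_contra hxR
  have hxR' : x ∉ box 3 R := fun hm => hxR (Finset.mem_coe.2 hm)
  have hle := hR x hxR'
  apply hx
  rw [Real.dist_eq, sub_zero, abs_of_nonneg (tau_nonneg _ _ _)]
  linarith

/-- **Face⁻ ↔ S.** -/
theorem summit_iff_subcritFace : _root_.PercolationContinuityZ3 ↔ SubcritFace :=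
  ⟨subcritFace_of_summit, summit_of_subcritFace⟩

/-- The regime split `Face⁺ ∧ Face⁻ → S` assembles trivially — and each piece is already `S`. -/
theorem summit_of_faces (h₁ : SupercritFace) (_h₂ : SubcritFace) : _root_.PercolationContinuityZ3 :=
  summit_of_supercritFace h₁

/-! ## §3 Splits of r2 itself

(a) by parameter: `r2 ↔ CritGoodBoxes ∧ SupercritGoodBoxes`, and `CritGoodBoxes ↔ S`
(`critGoodBoxes_iff`, first census) — the critical piece IS the summit, the other piece is known
(Grimmett (7.61)).
(b) by event: `G_n = CROSS_n ∩ UNIQ_n`; the pieces below are the two stubs of the lead's `birth`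
line re-typed as standalone Props (mine, not the skeleton's); the assembly is a union bound, and the
UNIQ piece gives `S` outright once CROSS holds at `p_c` (which follows from the closable CROSS piece
under the jump) — so the split's open content is again the summit. -/

/-- Parameter split, assembly. -/
theorem crux_of_paramSplit (hc : CritGoodBoxes) (hs : SupercritGoodBoxes) : GoodBoxesLikelyWhenPercolating :=
  crux_of_continuity_of_supercrit (critGoodBoxes_iff.1 hc) hs

/-- Parameter split: the critical piece alone is the summit. -/
example : CritGoodBoxes ↔ _root_.PercolationContinuityZ3 := critGoodBoxes_iff

/-- CROSS eventually likely wherever `θ > 0` (birth's closable stub, as a Prop). -/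
def CrossLikely : Prop :=
  ∀ p : unitInterval, 0 < theta (zdGraph 3) (0 : Site 3) p → ∀ δ : ℝ, 0 < δ →
    ∃ N : ℕ, ∀ n : ℕ, N ≤ n → (bondPercolation (zdGraph 3) p).real {ω | ¬ Cross n ω} < δ

/-- UNIQ frequently likely wherever `θ > 0` (birth's load-bearing stub, as a Prop). -/
def UniqFrequently : Prop :=
  ∀ p : unitInterval, 0 < theta (zdGraph 3) (0 : Site 3) p → ∀ δ : ℝ, 0 < δ →
    ∀ N : ℕ, ∃ n : ℕ, N ≤ n ∧ (bondPercolation (zdGraph 3) p).real {ω | ¬ Uniq n ω} < δ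

/-- Event split, assembly (union bound): `CrossLikely → UniqFrequently → r2`. -/
theorem crux_of_eventSplit (hC : CrossLikely) (hU : UniqFrequently) : GoodBoxesLikelyWhenPercolating := by
  intro p hp δ hδ
  obtain ⟨N, hN⟩ := hC p hp (δ / 2) (half_pos hδ)
  obtain ⟨n, hn, hUn⟩ := hU p hp (δ / 2) (half_pos hδ) (max N 1)
  refine ⟨n, (le_max_right N 1).trans hn, ?_⟩
  have hCn := hN n ((le_max_left N 1).trans hn)
  have h := one_sub_lt_measureReal_setOf_and (bondPercolation (zdGraph 3) p) hCn hUn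
  rw [add_halves] at h
  show 1 - δ < (bondPercolation (zdGraph 3) p).real (goodBox n)
  rw [goodBox_eq]
  exact h

/-- Event split: the UNIQ piece gives the summit once CROSS holds at `p_c` under the jump
(`uniq_fails_at_pc_of_jump`, first census, from NoGoodBoxAtPc). -/
theorem summit_of_uniqFrequently (hC : CrossLikely) (hU : UniqFrequently) :
    _root_.PercolationContinuityZ3 := by
  show theta (zdGraph 3) (0 : Site 3) (criticalProbI 3) = 0
  by_contra hne
  have hjump : 0 < theta (zdGraph 3) (0 : Site 3) (criticalProbI 3) :=
    lt_of_le_of_ne measureReal_nonneg (Ne.symm hne)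
  obtain ⟨δ₀, hδ₀, N, hN⟩ := uniq_fails_at_pc_of_jump (hC (criticalProbI 3) hjump) hjump
  obtain ⟨n, hn, hlt⟩ := hU (criticalProbI 3) hjump (δ₀ / 2) (half_pos hδ₀) N
  exact absurd (hN n hn) (not_le.2 hlt)

/-- (Of course the event split also reaches `S` through r2: recorded for the census table.) -/
example (hC : CrossLikely) (hU : UniqFrequently) : _root_.PercolationContinuityZ3 :=
  summit_of_crux (crux_of_eventSplit hC hU)


/-! ## §4 A refuted strengthening (census S6): one scale for all supercritical `p` -/

/-- **S6 is false, unconditionally.** "`∀ δ > 0, ∃ n ≥ 1, ∀ p > p_c, P_p(G_n) > 1 − δ`" (good boxes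
at a scale uniform in the supercritical parameter) fails: the bound passes to `p = p_c` through the
continuity of `q ↦ P_q(G_n)` (`continuous_real_goodBox`, a local event) and room on the right of
`p_c`, contradicting NoGoodBoxAtPc. So the uniformity that would make r2 "rigid enough to induct on"
is exactly what the tree already refutes. -/
theorem uniformSupercritGoodBoxes_false :
    ¬ (∀ δ : ℝ, 0 < δ → ∃ n : ℕ, 1 ≤ n ∧ ∀ p : unitInterval,
        criticalProb (zdGraph 3) (0 : Site 3) < (p : ℝ) →
          1 - δ < (bondPercolation (zdGraph 3) p).real (goodBox n)) := by
  intro h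
  obtain ⟨δ₀, hδ₀, hle⟩ := real_goodBox_criticalProbI_le
  obtain ⟨n, hn, hall⟩ := h (δ₀ / 2) (half_pos hδ₀)
  have hcrit : (bondPercolation (zdGraph 3) (criticalProbI 3)).real (goodBox n) < 1 - δ₀ / 2 := by
    have := hle n hn
    linarith
  have hopen : IsOpen ((fun q : unitInterval => (bondPercolation (zdGraph 3) q).real (goodBox n)) ⁻¹'
      Set.Iio (1 - δ₀ / 2)) :=
    (continuous_real_goodBox n).isOpen_preimage _ isOpen_Iio
  obtain ⟨r, hr, hball⟩ := Metric.isOpen_iff.1 hopen (criticalProbI 3) hcrit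
  obtain ⟨q, hq, hqball⟩ := exists_gt_pc_mem_ball hr
  have h1 : (bondPercolation (zdGraph 3) q).real (goodBox n) < 1 - δ₀ / 2 := hball hqball
  have h2 := hall q hq
  linarith

/-- By contrast the `p`-pointwise form is the known half (Grimmett (7.61)); recorded as the
implication used by the census: off `p_c`, r2 says exactly `SupercritGoodBoxes`. -/
example : GoodBoxesLikelyWhenPercolating → SupercritGoodBoxes := supercrit_of_crux

end Summit.CriticalPhenomena.PercolationContinuityZ3.Cruxes.GoodBoxesLikelyWhenPercolating.StrategyCensusR1

end
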